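import Summits.QuantumFields.YangMills.Theorems.UnitScaleGibbsNormalEquationNetFlux
import HarnessLib

/-!
# `UnitScaleGibbsNormalEquationColumnCharge` — COLUMN CHARGE: in the axial comb every direction-`0` column sum of the curl of a test field vanishes
# (the line-by-line sharpening of the NET-FLUX double count; w2-19936 g15's constraint (B) for the re-line of `stub_linTest`, kernel form)

Cell `ym3-torus` (YM ladder rung R3 = continuum SU(2) Yang–Mills on every three-torus — a RUNG, NOT d = 4, NOT infinite volume, NOT a mass gap, NOT Clay),
crux of record `UnitScaleTilt.HistoryTailL` (stmt-QuantumFields-19936); LINE 28 «GrossTransfer» registered on stmt-QuantumFields-23083; width seat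
`ym-ust-19936-w5` gen 16.  ✓`UnitScaleGibbsNormalEquationNetFlux.sum_ite_curl_eq_zero` says: the curl of ANY bond field has zero TOTAL flux through every
orientation.  The axial comb of lit `T4AxialGaugeSmallField` (root `lo`, tree = bonds with `lowPart b.dir (x − lo) = 0`) makes EVERY direction-`0` bond a
tree bond (`lowPart 0 v = 0`), so an off-tree test field VANISHES ON ALL DIRECTION-`0` BONDS; for such a field the flux of `du` through the orientation
`(0, μ)` vanishes not only in total but COLUMN BY COLUMN: for every transverse position `y`,
`Σ_{t ∈ ℤ_N} (du)_{⟨y[0 ↦ t]; 0, μ⟩} = Σ_t (u_μ(y[0 ↦ t+1]) − u_μ(y[0 ↦ t])) = 0` (telescoping round the `0`-circle).  Hence a residual `w − du`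
keeps EVERY column sum of `w` (`sum_col_sub_curl_eq`): for a block plaquette of orientation `(0, μ)` the net flux `(L·L)^j` of `linWeight j a` cannot even be
moved transversally by an admissible test field (w2-19936 g15, bus 2026-08-29T19:34Z, constraint (B); this file is its kernel certificate).

CONTENTS (finite sums; any `AddCommGroup`-valued bond field): `update_shift_eq` (bookkeeping: `(y[κ ↦ t]) + e_κ = y[κ ↦ t+1]`), `sum_zmod_shift_sub_eq_zero`
(telescoping on `ZMod N`), ★`sum_col_curl_eq_zero` / `sum_col_curl_eq_zero'` (column sums of `(du)_{(κ,μ)}` and `(du)_{(μ,κ)}` vanish when `u` vanishes on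
direction-`κ` bonds), `eq_zero_of_offTree_dir_zero` (the skeleton's off-tree support row ⇒ `u = 0` on direction-`0` bonds), ★`sum_col_curl_eq_zero_of_offTree`,
★`sum_col_sub_curl_eq` (the residual keeps the column sums).

HONEST SCOPE.  Lattice bookkeeping; proves no stub, refutes no registered statement; a constraint any re-line of `stub_linTest` with comb-gauged box-local test
fields must respect.  Nothing of (Q), 23083/23133/23134, K1 or `HistoryTailL` is proved.  YM₃ on T³ is rung R3 — NOT d = 4, NOT a mass gap, NOT Clay.
References: T. Bałaban, CMP **98** (1985) 17–51 [Balaban1985Averaging] ((5) p.18: bonds/plaquettes of `T^{(j)}`); CMP **95** (1984) 17–40 [Balaban1984PropagatorsI]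
((1.10) p.19: the axial gauge on the comb).
-/

set_option autoImplicit false

noncomputable section

open scoped BigOperators
open Literature.MathematicalPhysics.QuantumFieldTheory.Balaban1983to89
open Literature.MathematicalPhysics.QuantumFieldTheory.Balaban1983to89.T4AxialGaugeSmallField (castSite)
open Literature.MathematicalPhysics.QuantumFieldTheory.Balaban1983to89.B7Prop1Explicit (e)
open Literature.MathematicalPhysics.QuantumFieldTheory.Balaban1983to89.B8Lemma1NonAbelian (lowPart lowPart_apply)
open Summit.QuantumFields.YangMills.Theorems.UnitScaleGibbsActionDerivativeSlotCalculus (slotBond)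
open Summit.QuantumFields.YangMills.Theorems.UnitScaleGibbsNormalEquationNetFlux (curl_slotBond_eq)

namespace Summit.QuantumFields.YangMills.Theorems.UnitScaleGibbsNormalEquationColumnCharge

variable {P : Params} {j : ℕ}

/-- Bookkeeping: stepping the column point `y[κ ↦ t]` in direction `κ` gives `y[κ ↦ t + 1]`. [folklore] -/
theorem update_shift_eq (y : Site P j) (κ : Fin P.d) (t : ZMod (P.sitesPerDir j)) :
    Site.shift (Function.update y κ t : Site P j) κ = Function.update y κ (t + 1) := by
  simp only [Site.shift, Function.update_self, Function.update_idem]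

/-- Telescoping round the circle `ℤ_N`: `Σ_t (g(t+1) − g(t)) = 0`. [folklore] -/
theorem sum_zmod_shift_sub_eq_zero {M : Type*} [AddCommGroup M] {N : ℕ} [NeZero N] (g : ZMod N → M) :
    ∑ t : ZMod N, (g (t + 1) - g t) = 0 := by
  rw [Finset.sum_sub_distrib, sub_eq_zero]
  exact Fintype.sum_equiv (Equiv.addRight 1) _ _ (fun _ => rfl)

/-- ★ **COLUMN SUMS OF THE CURL VANISH, orientation `(κ, μ)` with `κ < μ`**: if `u` vanishes on every direction-`κ` bond, then for every transverse
position `y` the sum of `(du)_{⟨y[κ ↦ t]; κ, μ⟩}` over the `κ`-circle `t ∈ ℤ_N` is `0`. [folklore] -/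
theorem sum_col_curl_eq_zero {M : Type*} [AddCommGroup M] (u : PBond P j → M) {κ μ : Fin P.d} (hκμ : κ < μ)
    (hu : ∀ x : Site P j, u ⟨x, κ⟩ = 0) (y : Site P j) :
    ∑ t : ZMod (P.sitesPerDir j),
      (u (slotBond (⟨Function.update y κ t, κ, μ, hκμ⟩ : Plaq P j) 0) + u (slotBond (⟨Function.update y κ t, κ, μ, hκμ⟩ : Plaq P j) 1) -
        u (slotBond (⟨Function.update y κ t, κ, μ, hκμ⟩ : Plaq P j) 2) - u (slotBond (⟨Function.update y κ t, κ, μ, hκμ⟩ : Plaq P j) 3)) = 0 := by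
  simp only [curl_slotBond_eq, hu, zero_add, sub_zero, update_shift_eq]
  exact sum_zmod_shift_sub_eq_zero fun t => u ⟨Function.update y κ t, μ⟩

/-- ★ The same for the orientation `(μ, κ)` with `μ < κ`: `(du)_{⟨x; μ, κ⟩} = u⟨x,μ⟩ − u⟨x+e_κ,μ⟩` when `u` vanishes on direction-`κ` bonds, and its
`κ`-column sums vanish. [folklore] -/
theorem sum_col_curl_eq_zero' {M : Type*} [AddCommGroup M] (u : PBond P j → M) {μ κ : Fin P.d} (hμκ : μ < κ)
    (hu : ∀ x : Site P j, u ⟨x, κ⟩ = 0) (y : Site P j) :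
    ∑ t : ZMod (P.sitesPerDir j),
      (u (slotBond (⟨Function.update y κ t, μ, κ, hμκ⟩ : Plaq P j) 0) + u (slotBond (⟨Function.update y κ t, μ, κ, hμκ⟩ : Plaq P j) 1) -
        u (slotBond (⟨Function.update y κ t, μ, κ, hμκ⟩ : Plaq P j) 2) - u (slotBond (⟨Function.update y κ t, μ, κ, hμκ⟩ : Plaq P j) 3)) = 0 := by
  simp only [curl_slotBond_eq, hu, add_zero, sub_zero, update_shift_eq]
  have h := sum_zmod_shift_sub_eq_zero fun t => u ⟨Function.update y κ t, μ⟩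
  rw [← neg_eq_zero, ← h, ← Finset.sum_neg_distrib]
  exact Finset.sum_congr rfl fun t _ => by abel

/-- **THE SKELETON's OFF-TREE ROW KILLS DIRECTION `0`**: a test field supported on bonds with `lowPart b.dir (x − lo) ≠ 0` (the support row of
`stub_linTest`, with or without margin) vanishes on EVERY bond of the minimal direction `0` — `lowPart 0 v = 0` identically, every direction-`0` box bond
is a comb-tree bond. [cite: Balaban1984PropagatorsI, (1.10) p.19] -/
theorem eq_zero_of_offTree_dir_zero {M : Type*} [Zero M] {lo hi : Fin P.d → ℤ} (u : PBond P j → M)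
    (hsupp : ∀ b, u b ≠ 0 → ∃ x : Fin P.d → ℤ, lo ≤ x ∧ x + e b.dir ≤ hi ∧ b.src = castSite x ∧ lowPart b.dir (x - lo) ≠ 0)
    (x : Site P j) : u ⟨x, ⟨0, P.hd⟩⟩ = 0 := by
  by_contra h
  obtain ⟨z, -, -, -, hlow⟩ := hsupp _ h
  apply hlow
  funext k
  simp only [lowPart_apply, Pi.zero_apply]
  rw [if_neg]
  exact fun hk => Nat.not_lt_zero _ (Fin.lt_def.1 hk)

/-- ★ **COLUMN CHARGE OF AN ADMISSIBLE TEST FIELD IS ZERO**: under the off-tree support row, for every direction `μ` above `0` and every transverse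
position `y`, `Σ_{t ∈ ℤ_N} (du)_{⟨y[0 ↦ t]; 0, μ⟩} = 0`. [folklore] -/
theorem sum_col_curl_eq_zero_of_offTree {M : Type*} [AddCommGroup M] {lo hi : Fin P.d → ℤ} (u : PBond P j → M)
    (hsupp : ∀ b, u b ≠ 0 → ∃ x : Fin P.d → ℤ, lo ≤ x ∧ x + e b.dir ≤ hi ∧ b.src = castSite x ∧ lowPart b.dir (x - lo) ≠ 0)
    {μ : Fin P.d} (hμ : (⟨0, P.hd⟩ : Fin P.d) < μ) (y : Site P j) :
    ∑ t : ZMod (P.sitesPerDir j),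
      (u (slotBond (⟨Function.update y ⟨0, P.hd⟩ t, ⟨0, P.hd⟩, μ, hμ⟩ : Plaq P j) 0) +
          u (slotBond (⟨Function.update y ⟨0, P.hd⟩ t, ⟨0, P.hd⟩, μ, hμ⟩ : Plaq P j) 1) -
        u (slotBond (⟨Function.update y ⟨0, P.hd⟩ t, ⟨0, P.hd⟩, μ, hμ⟩ : Plaq P j) 2) -
        u (slotBond (⟨Function.update y ⟨0, P.hd⟩ t, ⟨0, P.hd⟩, μ, hμ⟩ : Plaq P j) 3)) = 0 :=
  sum_col_curl_eq_zero u hμ (eq_zero_of_offTree_dir_zero u hsupp) y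

/-- ★ **THE RESIDUAL KEEPS EVERY COLUMN SUM**: for a weight `w` and an admissible (off-tree) test field `u`, the direction-`0` column sums of `w − du`
through the orientation `(0, μ)` equal those of `w` — the column charges of a `(0,μ)`-oriented block plaquette cannot be moved transversally by `du`. [folklore] -/
theorem sum_col_sub_curl_eq {lo hi : Fin P.d → ℤ} (w : Plaq P j → ℝ) (u : PBond P j → ℝ)
    (hsupp : ∀ b, u b ≠ 0 → ∃ x : Fin P.d → ℤ, lo ≤ x ∧ x + e b.dir ≤ hi ∧ b.src = castSite x ∧ lowPart b.dir (x - lo) ≠ 0)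
    {μ : Fin P.d} (hμ : (⟨0, P.hd⟩ : Fin P.d) < μ) (y : Site P j) :
    ∑ t : ZMod (P.sitesPerDir j),
      (w ⟨Function.update y ⟨0, P.hd⟩ t, ⟨0, P.hd⟩, μ, hμ⟩ -
        (u (slotBond (⟨Function.update y ⟨0, P.hd⟩ t, ⟨0, P.hd⟩, μ, hμ⟩ : Plaq P j) 0) +
            u (slotBond (⟨Function.update y ⟨0, P.hd⟩ t, ⟨0, P.hd⟩, μ, hμ⟩ : Plaq P j) 1) -
          u (slotBond (⟨Function.update y ⟨0, P.hd⟩ t, ⟨0, P.hd⟩, μ, hμ⟩ : Plaq P j) 2) -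
          u (slotBond (⟨Function.update y ⟨0, P.hd⟩ t, ⟨0, P.hd⟩, μ, hμ⟩ : Plaq P j) 3))) =
      ∑ t : ZMod (P.sitesPerDir j), w ⟨Function.update y ⟨0, P.hd⟩ t, ⟨0, P.hd⟩, μ, hμ⟩ := by
  rw [Finset.sum_sub_distrib, sum_col_curl_eq_zero_of_offTree u hsupp hμ y, sub_zero]

end Summit.QuantumFields.YangMills.Theorems.UnitScaleGibbsNormalEquationColumnCharge

end
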